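import Summits.BirchSwinnertonDyer.BirchSwinnertonDyer.Theorems.Rank2Observatory2DescZ2QuadPID
import Summits.BirchSwinnertonDyer.BirchSwinnertonDyer.Theorems.Rank2Observatory2DescZ2Units
import Mathlib.Tactic.NormNum.Prime
import HarnessLib

/-!
# BirchSwinnertonDyer — rank ≥ 2 observatory: the real quadratic field `ℚ(√769)` certified

HONEST FRAMING: per-curve certified theorems and census instruments; no claim on BSD in rank ≥ 2.

Per-field file of the successor instrument KERNEL-2DESC-Z2 (spec
`code/b2b-bsdr2-cert-3/kernel-2desc-z2/README-Z2.md`), the `2`-descent field of the `ℤ/2`-rows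
`392190k1` (`θ = −11073 + 769ω`) and `392190n1` (`θ = −129 + ω`): `K = ℚ(ω)`, `ω² − ω − 192 = 0`,
`Δ = 769` (prime).

* `f = X² − X − 192` irreducible (`769` is not a square: not even modulo `7`), `[K : ℚ] = 2`,
  `𝓞 K = ℤ[ω]`, `d_K = 769`;
* CLASS NUMBER ONE by certificate: Minkowski `√769/2 < 14` (tight: `13.87`); `2, 3, 5` split and each
  residue map is killed by an explicit prime element of norm `±p` (generators from `bnfisprincipal`,
  kit pari j208916); `7, 11, 13` are inert (`f` has no root), so their condition is vacuous;
* unit rank `1`; the units `−1`, `ε = 15777151472704763 + 1180445209689554ω` (norm `−1`) are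
  independent modulo squares by the Legendre certificates at `ψ₁₇ : ω ↦ 8` (`−1 ↦ 16 = 4²`, `ε ↦ 6`
  non-square) and `ψ₃ : ω ↦ 0` (`−1 ↦ 2`, `ε ↦ 2`, non-squares); with unit rank `1` every unit is a
  square times a sub-product (`units_span`; no claim that `ε` is fundamental is needed or made).

Sorry-free; axioms `propext`, `Classical.choice`, `Quot.sound`. Field data: kit pari j208916.
[cite: Marcus2018, Ch. 2 Ex. 27, Ch. 3 Thm. 22 & 27, Ch. 5 Cor. 2 of Thm. 37]
-/

-- single-conjunct summit: `Summit.BirchSwinnertonDyer.BirchSwinnertonDyer.…` repeats the name by design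
set_option linter.dupNamespace false

noncomputable section

open scoped Classical NumberField

open Literature.NumberTheory.NumberFields Polynomial Module NumberField

namespace Summit.BirchSwinnertonDyer.BirchSwinnertonDyer.Rank2Observatory.TwoDescZ2

open TwoDescCubic

namespace QuadField769

/-! ## The field -/

/-- `Δ(X² − X − 192) = 769`. [folklore] -/
theorem disc_eq : MonicQuad.disc (-1) (-192) = 769 := by norm_num [MonicQuad.disc]

/-- `X² − X − 192` is irreducible over `ℚ` (`769` is not a square: not even modulo `7`). [folklore] -/
theorem irreducible : Irreducible (MonicQuad.polyQ (-1) (-192)) :=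
  MonicQuad.irreducible_polyQ (by rw [disc_eq]; exact MonicQuad.not_isSquare_of_zmod 7 (by decide))

/-- Irreducibility as an instance, so that `QuadField -1 -192` is a field. [folklore] -/
instance : Fact (Irreducible (MonicQuad.polyQ (-1) (-192))) := ⟨irreducible⟩

/-- `f(ω) = 0`. [folklore] -/
theorem aeval_ω : aeval (QuadField.root (-1) (-192)) (MonicQuad.poly (-1) (-192)) = 0 :=
  QuadField.aeval_root (-1) (-192)

/-- `[K : ℚ] = 2`. [folklore] -/
theorem finrank_eq : finrank ℚ (QuadField (-1) (-192)) = 2 := QuadField.finrank_eq (-1) (-192)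

/-- `0 < Δ`. [folklore] -/
theorem disc_pos : 0 < MonicQuad.disc (-1) (-192) := by rw [disc_eq]; norm_num

/-- The index condition (`769` is prime, so squarefree), so `𝓞 K = ℤ[ω]`. [cite: Marcus2018, Ch. 2, Ex. 27] -/
theorem hsq : ∀ r e : ℤ, MonicQuad.disc (-1) (-192) = r ^ 2 * e → 2 < |e| → IsUnit r :=
  MonicQuad.sqCond_of_squarefree (by
    rw [disc_eq]
    exact_mod_cast Int.squarefree_natCast.mpr (Nat.prime_iff.mp (by norm_num)).squarefree)

/-- `d_K = 769`. [cite: Marcus2018, Ch. 2, Ex. 27] -/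
theorem discr_eq : NumberField.discr (QuadField (-1) (-192)) = 769 := by
  rw [MonicQuad.discr_eq_disc irreducible aeval_ω finrank_eq hsq, disc_eq]

/-- Every algebraic integer is `p + qω`. [cite: Marcus2018, Ch. 2, Ex. 27] -/
theorem exists_int_coords (x : 𝓞 (QuadField (-1) (-192))) :
    ∃ p q : ℤ, (x : QuadField (-1) (-192)) = (p : QuadField (-1) (-192)) + (q : QuadField (-1) (-192)) * QuadField.root (-1) (-192) :=
  MonicQuad.exists_int_coords irreducible aeval_ω finrank_eq hsq x

/-- The relation `ω² = ω + 192` in `𝓞 K`. [folklore] -/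
theorem ωi_rel : (MonicQuad.thetaInt aeval_ω) ^ 2 = MonicQuad.thetaInt aeval_ω + 192 := by
  have h := MonicQuad.thetaInt_rel aeval_ω
  push_cast at h
  linear_combination h

/-! ## Class number one -/

/-- Certificate at `2` (split, `ω ≡ 0, 1`): `ω ≡ 0` is killed by `−75950 + 5287ω`, `ω ≡ 1` by
`−70663 − 5287ω`, both of norm `2`. [cite: Marcus2018, Ch. 3, Thm. 22] -/
theorem cert2 (ψ : 𝓞 (QuadField (-1) (-192)) →+* ZMod 2) : ∃ e : 𝓞 (QuadField (-1) (-192)), ψ e = 0 ∧ Prime e := by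
  refine MonicQuad.cert_of_cases aeval_ω ψ (fun t ht _ => ?_)
  have hcases : ∀ t : ZMod 2, t = 0 ∨ t = 1 := by decide
  rcases hcases t with rfl | rfl
  · exact ⟨MonicQuad.lin aeval_ω (-75950) 5287, by rw [MonicQuad.map_lin aeval_ω ψ ht]; decide,
      MonicQuad.lin_prime_of_prime irreducible aeval_ω finrank_eq (-75950) 5287 (n := 2)
        (by norm_num [MonicQuad.normForm]) (by norm_num)⟩
  · exact ⟨MonicQuad.lin aeval_ω (-70663) (-5287), by rw [MonicQuad.map_lin aeval_ω ψ ht]; decide,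
      MonicQuad.lin_prime_of_prime irreducible aeval_ω finrank_eq (-70663) (-5287) (n := 2)
        (by norm_num [MonicQuad.normForm]) (by norm_num)⟩

/-- Certificate at `3` (split, `ω ≡ 0, 1`): `ω ≡ 0` is killed by `747 − 52ω`, `ω ≡ 1` by `−695 − 52ω`,
both of norm `−3`. [cite: Marcus2018, Ch. 3, Thm. 22] -/
theorem cert3 (ψ : 𝓞 (QuadField (-1) (-192)) →+* ZMod 3) : ∃ e : 𝓞 (QuadField (-1) (-192)), ψ e = 0 ∧ Prime e := by
  refine MonicQuad.cert_of_cases aeval_ω ψ (fun t ht hF => ?_)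
  have hroots : ∀ t : ZMod 3, t ^ 2 + ((-1 : ℤ) : ZMod 3) * t + ((-192 : ℤ) : ZMod 3) = 0 → t = 0 ∨ t = 1 := by
    decide
  rcases hroots t hF with rfl | rfl
  · exact ⟨MonicQuad.lin aeval_ω 747 (-52), by rw [MonicQuad.map_lin aeval_ω ψ ht]; decide,
      MonicQuad.lin_prime_of_prime irreducible aeval_ω finrank_eq 747 (-52) (n := -3)
        (by norm_num [MonicQuad.normForm]) (by norm_num)⟩
  · exact ⟨MonicQuad.lin aeval_ω (-695) (-52), by rw [MonicQuad.map_lin aeval_ω ψ ht]; decide,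
      MonicQuad.lin_prime_of_prime irreducible aeval_ω finrank_eq (-695) (-52) (n := -3)
        (by norm_num [MonicQuad.normForm]) (by norm_num)⟩

/-- Certificate at `5` (split, `ω ≡ 2, 4`): `ω ≡ 2` is killed by `−13877 + 966ω`, `ω ≡ 4` by
`12911 + 966ω`, both of norm `−5`. [cite: Marcus2018, Ch. 3, Thm. 22] -/
theorem cert5 (ψ : 𝓞 (QuadField (-1) (-192)) →+* ZMod 5) : ∃ e : 𝓞 (QuadField (-1) (-192)), ψ e = 0 ∧ Prime e := by
  refine MonicQuad.cert_of_cases aeval_ω ψ (fun t ht hF => ?_)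
  have hroots : ∀ t : ZMod 5, t ^ 2 + ((-1 : ℤ) : ZMod 5) * t + ((-192 : ℤ) : ZMod 5) = 0 → t = 2 ∨ t = 4 := by
    decide
  rcases hroots t hF with rfl | rfl
  · exact ⟨MonicQuad.lin aeval_ω (-13877) 966, by rw [MonicQuad.map_lin aeval_ω ψ ht]; decide,
      MonicQuad.lin_prime_of_prime irreducible aeval_ω finrank_eq (-13877) 966 (n := -5)
        (by norm_num [MonicQuad.normForm]) (by norm_num)⟩
  · exact ⟨MonicQuad.lin aeval_ω 12911 966, by rw [MonicQuad.map_lin aeval_ω ψ ht]; decide,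
      MonicQuad.lin_prime_of_prime irreducible aeval_ω finrank_eq 12911 966 (n := -5)
        (by norm_num [MonicQuad.normForm]) (by norm_num)⟩

/-- The certificate below the Minkowski bound `14`: `2, 3, 5` by `cert2/3/5`; `7, 11, 13` inert (no
root of `f`, no residue map). [cite: Marcus2018, Ch. 5, Cor. 2 of Thm. 37] -/
theorem cert (p : ℕ) (hp14 : p < 14) (hp : p.Prime) (ψ : 𝓞 (QuadField (-1) (-192)) →+* ZMod p) :
    ∃ e : 𝓞 (QuadField (-1) (-192)), ψ e = 0 ∧ Prime e := by
  interval_cases p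
  · exact absurd hp (by norm_num)
  · exact absurd hp (by norm_num)
  · exact cert2 ψ
  · exact cert3 ψ
  · exact absurd hp (by norm_num)
  · exact cert5 ψ
  · exact absurd hp (by norm_num)
  · exact MonicQuad.cert_of_no_root aeval_ω ψ (by decide)
  · exact absurd hp (by norm_num)
  · exact absurd hp (by norm_num)
  · exact absurd hp (by norm_num)
  · exact MonicQuad.cert_of_no_root aeval_ω ψ (by decide)
  · exact absurd hp (by norm_num)
  · exact MonicQuad.cert_of_no_root aeval_ω ψ (by decide)

/-- **`𝓞 ℚ(√769)` is a principal ideal domain.** [cite: Marcus2018, Ch. 5, Cor. 2 of Thm. 37] -/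
instance : IsPrincipalIdealRing (𝓞 (QuadField (-1) (-192))) :=
  isPrincipalIdealRing_of_cert_lt₂ irreducible aeval_ω finrank_eq disc_pos (b' := 14)
    (by rw [disc_eq]; norm_num) cert

/-! ## Signature, residue maps -/

/-- Unit rank `1`. [cite: Marcus2018, Ch. 5] -/
theorem rank_eq : NumberField.Units.rank (QuadField (-1) (-192)) = 1 :=
  units_rank_eq_one_of_disc_pos irreducible aeval_ω finrank_eq disc_pos

/-- A real embedding exists. [folklore] -/
theorem exists_rho : Nonempty (QuadField (-1) (-192) →+* ℝ) :=
  exists_ringHom_real_of_disc_pos irreducible aeval_ω finrank_eq disc_pos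

/-- The residue map `ψ₁₇ : ω ↦ 8`. [cite: Marcus2018, Ch. 3, Thm. 27] -/
theorem exists_psi17 : ∃ ψ : 𝓞 (QuadField (-1) (-192)) →+* ZMod 17, ψ (MonicQuad.thetaInt aeval_ω) = 8 :=
  MonicQuad.exists_ringHom_of_root irreducible aeval_ω finrank_eq hsq (8 : ZMod 17) (by decide)

/-- The residue map `ψ₃ : ω ↦ 0`. [cite: Marcus2018, Ch. 3, Thm. 27] -/
theorem exists_psi3 : ∃ ψ : 𝓞 (QuadField (-1) (-192)) →+* ZMod 3, ψ (MonicQuad.thetaInt aeval_ω) = 0 :=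
  MonicQuad.exists_ringHom_of_root irreducible aeval_ω finrank_eq hsq (0 : ZMod 3) (by decide)

/-- `17` is prime (instance for `legendreSym 17`). [folklore] -/
instance fact_prime_17 : Fact (Nat.Prime 17) := ⟨by norm_num⟩

/-- `3` is prime (instance for `legendreSym 3`). [folklore] -/
instance fact_prime_3 : Fact (Nat.Prime 3) := ⟨by norm_num⟩

/-! ## Units modulo squares -/

/-- The unit `−1`. [folklore] -/
def negOne : (𝓞 (QuadField (-1) (-192)))ˣ :=
  ⟨MonicQuad.lin aeval_ω (-1) 0, MonicQuad.lin aeval_ω (-1) 0, by simp [MonicQuad.lin], by simp [MonicQuad.lin]⟩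

/-- The unit `ε = 15777151472704763 + 1180445209689554ω` (norm `−1`; inverse
`−16957596682394317 + 1180445209689554ω = −ε̄`). [folklore] -/
def fu : (𝓞 (QuadField (-1) (-192)))ˣ :=
  ⟨MonicQuad.lin aeval_ω 15777151472704763 1180445209689554,
    MonicQuad.lin aeval_ω (-16957596682394317) 1180445209689554,
    by simp only [MonicQuad.lin]; push_cast; linear_combination (1180445209689554 ^ 2 : 𝓞 (QuadField (-1) (-192))) * ωi_rel,
    by simp only [MonicQuad.lin]; push_cast; linear_combination (1180445209689554 ^ 2 : 𝓞 (QuadField (-1) (-192))) * ωi_rel⟩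

/-- The unit family `(−1, ε)`. [folklore] -/
def units : Fin 2 → (𝓞 (QuadField (-1) (-192)))ˣ := ![negOne, fu]

/-- Images under `ψ₁₇` (`ω ↦ 8`): `−1 ↦ 16`, `ε ↦ 6`. [folklore] -/
theorem units_psi17 (ψ : 𝓞 (QuadField (-1) (-192)) →+* ZMod 17) (hψ : ψ (MonicQuad.thetaInt aeval_ω) = 8)
    (i : Fin 2) : ψ ((units i : (𝓞 (QuadField (-1) (-192)))ˣ) : 𝓞 (QuadField (-1) (-192))) = ((![16, 6] : Fin 2 → ℤ) i : ZMod 17) := by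
  fin_cases i
  · show ψ (MonicQuad.lin aeval_ω (-1) 0) = ((16 : ℤ) : ZMod 17)
    rw [MonicQuad.map_lin aeval_ω ψ hψ]; decide
  · show ψ (MonicQuad.lin aeval_ω 15777151472704763 1180445209689554) = ((6 : ℤ) : ZMod 17)
    rw [MonicQuad.map_lin aeval_ω ψ hψ]; decide

/-- Images under `ψ₃` (`ω ↦ 0`): `−1 ↦ 2`, `ε ↦ 2`. [folklore] -/
theorem units_psi3 (ψ : 𝓞 (QuadField (-1) (-192)) →+* ZMod 3) (hψ : ψ (MonicQuad.thetaInt aeval_ω) = 0)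
    (i : Fin 2) : ψ ((units i : (𝓞 (QuadField (-1) (-192)))ˣ) : 𝓞 (QuadField (-1) (-192))) = ((![2, 2] : Fin 2 → ℤ) i : ZMod 3) := by
  fin_cases i
  · show ψ (MonicQuad.lin aeval_ω (-1) 0) = ((2 : ℤ) : ZMod 3)
    rw [MonicQuad.map_lin aeval_ω ψ hψ]; decide
  · show ψ (MonicQuad.lin aeval_ω 15777151472704763 1180445209689554) = ((2 : ℤ) : ZMod 3)
    rw [MonicQuad.map_lin aeval_ω ψ hψ]; decide

/-- **The unit family is independent modulo squares** (Legendre certificates at `ψ₁₇`, `ψ₃`).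
[folklore] -/
theorem units_indep (T : Finset (Fin 2)) (hT : IsSquare (∏ i ∈ T, units i)) : T = ∅ := by
  obtain ⟨ψ17, hψ17⟩ := exists_psi17
  obtain ⟨ψ3, hψ3⟩ := exists_psi3
  have hT' : IsSquare (∏ i ∈ T, ((units i : (𝓞 (QuadField (-1) (-192)))ˣ) : 𝓞 (QuadField (-1) (-192)))) := by
    obtain ⟨r, hr⟩ := hT
    refine ⟨(r : 𝓞 (QuadField (-1) (-192))), ?_⟩
    have h := congrArg (fun z : (𝓞 (QuadField (-1) (-192)))ˣ => (z : 𝓞 (QuadField (-1) (-192)))) hr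
    simpa only [Units.coe_prod, Units.val_mul] using h
  refine indep_of_parity_certificate
    (fun i => ((units i : (𝓞 (QuadField (-1) (-192)))ˣ) : 𝓞 (QuadField (-1) (-192))))
    (![![false, true], ![true, true]] : Fin 2 → Fin 2 → Bool) ?_ (by decide) T hT'
  intro k S hS
  fin_cases k
  · have h := even_card_of_isSquare_legendre (p := 17) ψ17
      (fun i => ((units i : (𝓞 (QuadField (-1) (-192)))ˣ) : 𝓞 (QuadField (-1) (-192))))
      (![16, 6] : Fin 2 → ℤ) (units_psi17 ψ17 hψ17) (by decide) hS
    have h1 : legendreSym 17 16 = 1 :=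
      (legendreSym.eq_one_iff 17 (by decide)).mpr ⟨4, by decide⟩
    have h2 : legendreSym 17 6 = -1 :=
      (legendreSym.eq_neg_one_iff 17).mpr (by unfold IsSquare; decide)
    convert h using 2
    refine Finset.filter_congr (fun i _ => ?_)
    fin_cases i
    · simp [h1]
    · simp [h2]
  · have h := even_card_of_isSquare_legendre (p := 3) ψ3
      (fun i => ((units i : (𝓞 (QuadField (-1) (-192)))ˣ) : 𝓞 (QuadField (-1) (-192))))
      (![2, 2] : Fin 2 → ℤ) (units_psi3 ψ3 hψ3) (by decide) hS
    have h1 : legendreSym 3 2 = -1 :=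
      (legendreSym.eq_neg_one_iff 3).mpr (by unfold IsSquare; decide)
    convert h using 2
    refine Finset.filter_congr (fun i _ => ?_)
    fin_cases i
    · simp [h1]
    · simp [h1]

/-- **The unit family spans `(𝓞 K)ˣ` modulo squares** (rank `1`, real field: torsion `±1`).
[cite: Marcus2018, Ch. 5] -/
theorem units_span (u : (𝓞 (QuadField (-1) (-192)))ˣ) : ∃ T : Finset (Fin 2), IsSquare (u * ∏ i ∈ T, units i) := by
  obtain ⟨ρ⟩ := exists_rho
  exact exists_isSquare_unit_mul_prod_of_real ρ (by rw [rank_eq]) units units_indep u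

end QuadField769

end Summit.BirchSwinnertonDyer.BirchSwinnertonDyer.Rank2Observatory.TwoDescZ2

end
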